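import Literature.AlgebraicGeometry.ShimuraVarieties.UnitaryCurveConjugateSliceEqOfTwistedRecip   -- ★ p849897 (mine): the conjugate slice equals the second slice given the TWISTED law at `σ⁻¹`'s twist
import Literature.AlgebraicGeometry.ShimuraVarieties.UnitaryShimuraCanonicalModelArtin            -- ★ `exists_finiteIdele_isArtinCorrespondent_algEquiv`
import Literature.AlgebraicGeometry.ShimuraVarieties.UnitaryGroupDiagonalTwistExists              -- ★ `exists_isDiagTwistGS_recipFactor'`
import HarnessLib

/-!
# The conjugate slice equals the second slice, given the FORWARD twisted reciprocity law `σ • f[x₀, a] = f₂[x₀, d·a]`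
# ([Milne 2005] Thm. 13.6 p. 118 with two slices; the round trip `[x₀, d·d′·b] = [x₀, b]` of Def. 12.8 (62) at `σ` and `σ⁻¹`)

Topic `AlgebraicGeometry/ShimuraVarieties`, namespace `…ShimuraVarieties.UnitaryCanonicalModel` (the object of ★ `UnitaryShimuraCurveRecord`).  THEOREMS ONLY
(no definition, no instance, no notation, no named fact, no `sorry`).  Cell `hodgecm-mathlib` (D-0151), P6 «MOD programme», crux hLiu418 (stmt-HodgeConjecture-24832,
`--supports`, count-neutral), line «L4», X-LEAF `Lines/F0_P6a_EExports.lean` (A-p01 (g28)) socket `stub_ESHEET`, organ map `MEMO-ESHEET-organs.v2` (S3)∕(S3♯)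
(LA4-plan (g2) DEAL #28 → LA4-p03 (g2)).  ED. 2 OF THE (S3) ORGAN ★ `RecordSystemGS.conjSlice_eq_sliceTwo_of_twisted_recip`: that head takes the twisted law in the
shape «`σ|_ℚ • f[x₀, d′·b] = f₂[x₀, b]`, `d′` the twist of the record's reciprocity at `σ⁻¹`», whereas the special-pair reciprocity square WITH CENTRAL TWIST — ★
`Summit…Theorems.F0P6aSpecialPairRecipDatumCentralTwist.smul_f_mk_eq_fTwo_mk_of_cmDatum_central` fed by ★ `exists_siegelRecipDatum_centralTwist_of_isGalois` (S2a)
and the tensored-family reading (S2b) — delivers it in the FORWARD shape «`σ|_ℚ • f[x₀, a] = f₂[x₀, d·a]`, `d` the twist at `σ` itself».  The two shapes are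
exchanged by the ROUND TRIP of the record's own reciprocity (field `recip`, [Milne 2005] Def. 12.8 (62)) at `σ` and at `σ⁻¹`: `pts⁻¹[x₀, b] = σ • σ⁻¹ • pts⁻¹[x₀, b]
= σ • pts⁻¹[x₀, d′ b] = pts⁻¹[x₀, d d′ b]`, so `[x₀, d·d′·b] = [x₀, b]` (§1); hence the forward law gives the twisted one (§1) and the head and its
underlying-morphism form follow with the auxiliary `s′, d′` of `σ⁻¹` DISCHARGED by ★ `exists_finiteIdele_isArtinCorrespondent_algEquiv` ∕ ★ `exists_isDiagTwistGS_recipFactor'` (§2).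
HONEST LABEL: HC_CM is proved only modulo the 2 remaining named inputs (hLiu418 24832, h413 24833) until rung 0 closes; this file is generic and count-neutral.

* §1 **`RecordSystemGS.mk_mul_mul_eq_mk_of_recip_recip`** — `[x₀, d·(d′·b)] = [x₀, b]`; **`RecordSystemGS.twisted_recip_of_forward_recip`** — forward law ⇒ twisted law;
* §2 **`RecordSystemGS.conjSlice_eq_sliceTwo_of_forward_recip`** — THE HEAD with the forward law (only `s ↔ σ` and its twist `d` as data);
  **`RecordSystemGS.gal_comp_sliceComplex_comp_gal_eq_sliceTwo_of_forward_recip`** — the same on underlying morphisms: `gal σL⁻¹ ≫ ψ.left ≫ gal σ|_ℚ = ψ₂.left`.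

## References
* [Milne2005ShimuraVarieties] J. S. Milne, *Introduction to Shimura varieties* (2005; rev. 2017), §13: Lemma 13.5 and Thm. 13.6 p. 118 (L29–41); Def. 12.8 (61)–(62) p. 114.
* [Shimura1998] G. Shimura, *Abelian Varieties with Complex Multiplication and Modular Functions* (1998), §18.6 (pp. 124–127).
* [Deligne1979ShimuraVarieties] P. Deligne, *Variétés de Shimura* (1979), 2.2.4–2.2.6.
-/

set_option autoImplicit false

noncomputable section

open Function MulAction Topology NumberField IsDedekindDomain CategoryTheory CategoryTheory.Limits Matrix
  AlgebraicGeometry Cardinal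
open scoped Matrix ComplexOrder
open Literature.AlgebraicGeometry.Motives Literature.NumberTheory.Automorphic Literature.NumberTheory.Automorphic.UnitaryGroup
open Literature.NumberTheory.Automorphic.Liu2021.AppendixC (C5.OpenCompactSubgroup C5.SmallLevel)
open Literature.AlgebraicGeometry.Motives.AbelianVariety (bcSpec bcFunctor specAut)

namespace Literature.AlgebraicGeometry.ShimuraVarieties.UnitaryCanonicalModel

variable {L : Type} [Field L] [NumberField L] [IsCMField L] {Jstar : Matrix (Fin 2) (Fin 2) L} {τ : L →+* ℂ}
  {K₀ : C5.OpenCompactSubgroup ↥(finAdelic (↥(maximalRealSubfield L)) L (IsCMField.complexConj L) 2 Jstar)}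

/-! ### §1 The round trip of the record's reciprocity at `σ` and `σ⁻¹` -/

/-- **`[x₀, d·(d′·b)] = [x₀, b]`**: for `σ ∈ Aut(ℂ∕τL)` with Artin correspondent `s` and twist `d` at the special point `x₀ = [τw]`, and `σ⁻¹` with `s′`, `d′`,
the record's reciprocity ([Milne 2005] Def. 12.8 (62)) at `σ⁻¹` and then at `σ` reads `pts⁻¹[x₀, b] = σ • σ⁻¹ • pts⁻¹[x₀, b] = σ • pts⁻¹[x₀, d′·b] =
pts⁻¹[x₀, d·d′·b]`, and `pts` is a bijection. [cite: Milne2005ShimuraVarieties, Def. 12.8 (62) p. 114; Thm. 13.6 p. 118 L33–36]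
[cite: Deligne1979ShimuraVarieties, 2.2.4–2.2.5] -/
theorem RecordSystemGS.mk_mul_mul_eq_mk_of_recip_recip (S : RecordSystemGS L Jstar τ K₀) (K : C5.SmallLevel K₀)
    (σL : letI : Algebra L ℂ := τ.toAlgebra; ℂ ≃ₐ[L] ℂ)
    {w : Fin 2 → L} (hw : (fun i => τ (w i)) ∈ negCone (Jstar.map τ)) {s s' : (FiniteAdeleRing (𝓞 L) L)ˣ}
    (hs : letI : Algebra L ℂ := τ.toAlgebra; IsArtinCorrespondent L τ s σL.toRingEquiv)
    (hs' : letI : Algebra L ℂ := τ.toAlgebra; IsArtinCorrespondent L τ s' σL⁻¹.toRingEquiv)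
    {d d' : ↥(finAdelic (↥(maximalRealSubfield L)) L (IsCMField.complexConj L) 2 Jstar)}
    (hd : IsDiagTwistGS L Jstar w (recipFactor L s) d) (hd' : IsDiagTwistGS L Jstar w (recipFactor L s') d')
    (b : ↥(finAdelic (↥(maximalRealSubfield L)) L (IsCMField.complexConj L) 2 Jstar)) :
    ShimuraSetGS.mk L Jstar τ K.1.1 (fun i => τ (w i)) hw (d * (d' * b)) = ShimuraSetGS.mk L Jstar τ K.1.1 (fun i => τ (w i)) hw b := by
  letI iL : Algebra L ℂ := τ.toAlgebra
  apply (S.pts K).symm.injective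
  rw [← S.recip K σL s hs w hw d hd (d' * b), ← S.recip K σL⁻¹ s' hs' w hw d' hd' b, smul_inv_smul]

/-- **The FORWARD law gives the TWISTED law**: if `σ|_ℚ • f[x₀, a] = f₂[x₀, d·a]` for all `a` (`d` the twist at `σ`), then `σ|_ℚ • f[x₀, d′·b] = f₂[x₀, b]` for all
`b` (`d′` the twist at `σ⁻¹`) — take `a := d′·b` and use the round trip `[x₀, d·d′·b] = [x₀, b]`. [cite: Milne2005ShimuraVarieties, Def. 12.8 (62) p. 114; Thm. 13.6 p. 118 L33–39] -/
theorem RecordSystemGS.twisted_recip_of_forward_recip (S : RecordSystemGS L Jstar τ K₀) (K : C5.SmallLevel K₀) (M : SchemeOver ℚ)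
    (f f₂ : ShimuraSetGS L Jstar τ K.1.1 → ComplexPoints M)
    (σL : letI : Algebra L ℂ := τ.toAlgebra; ℂ ≃ₐ[L] ℂ)
    {w : Fin 2 → L} (hw : (fun i => τ (w i)) ∈ negCone (Jstar.map τ)) {s s' : (FiniteAdeleRing (𝓞 L) L)ˣ}
    (hs : letI : Algebra L ℂ := τ.toAlgebra; IsArtinCorrespondent L τ s σL.toRingEquiv)
    (hs' : letI : Algebra L ℂ := τ.toAlgebra; IsArtinCorrespondent L τ s' σL⁻¹.toRingEquiv)
    {d d' : ↥(finAdelic (↥(maximalRealSubfield L)) L (IsCMField.complexConj L) 2 Jstar)}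
    (hd : IsDiagTwistGS L Jstar w (recipFactor L s) d) (hd' : IsDiagTwistGS L Jstar w (recipFactor L s') d')
    (hfw : letI : Algebra L ℂ := τ.toAlgebra
      ∀ a : ↥(finAdelic (↥(maximalRealSubfield L)) L (IsCMField.complexConj L) 2 Jstar),
        (σL.restrictScalars ℚ) • f (ShimuraSetGS.mk L Jstar τ K.1.1 (fun i => τ (w i)) hw a) =
          f₂ (ShimuraSetGS.mk L Jstar τ K.1.1 (fun i => τ (w i)) hw (d * a))) :
    letI : Algebra L ℂ := τ.toAlgebra
    ∀ b : ↥(finAdelic (↥(maximalRealSubfield L)) L (IsCMField.complexConj L) 2 Jstar),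
      (σL.restrictScalars ℚ) • f (ShimuraSetGS.mk L Jstar τ K.1.1 (fun i => τ (w i)) hw (d' * b)) =
        f₂ (ShimuraSetGS.mk L Jstar τ K.1.1 (fun i => τ (w i)) hw b) := by
  letI iL : Algebra L ℂ := τ.toAlgebra
  intro b
  rw [hfw (d' * b), S.mk_mul_mul_eq_mk_of_recip_recip K σL hw hs hs' hd hd' b]

/-! ### §2 The head with the forward law: `s′`, `d′` of `σ⁻¹` discharged by existence -/

section TwoSlices

variable (S : RecordSystemGS L Jstar τ K₀) (K : C5.SmallLevel K₀) (M : SchemeOver ℚ)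
  (f f₂ : ShimuraSetGS L Jstar τ K.1.1 → ComplexPoints M)
  (ψ ψ₂ : (Motives.baseChangeHom τ).obj (S.M.obj K) ⟶ (Motives.baseChange ℚ ℂ).obj M)
  (hψ : letI : Algebra L ℂ := τ.toAlgebra
    ∀ P : ComplexPoints (S.M.obj K),
      (AlgPoints.map ψ (AlgPoints.baseChangeEquiv τ (S.M.obj K) P)).left ≫ Motives.baseChangeHomFst (algebraMap ℚ ℂ) M =
        (f (S.pts K P)).left)
  (hψ₂ : letI : Algebra L ℂ := τ.toAlgebra
    ∀ P : ComplexPoints (S.M.obj K),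
      (AlgPoints.map ψ₂ (AlgPoints.baseChangeEquiv τ (S.M.obj K) P)).left ≫ Motives.baseChangeHomFst (algebraMap ℚ ℂ) M =
        (f₂ (S.pts K P)).left)
  (t : letI : Algebra L ℂ := τ.toAlgebra; GaloisDescent.bc ℂ (S.M.obj K) ⟶ GaloisDescent.bc ℂ M) (ht : t = ψ.left)
  (t₂ : letI : Algebra L ℂ := τ.toAlgebra; GaloisDescent.bc ℂ (S.M.obj K) ⟶ GaloisDescent.bc ℂ M) (ht₂ : t₂ = ψ₂.left)

set_option maxHeartbeats 800000 in -- large adelic ∕ Shimura-set terms: instance-heavy statements (as ★ `UnitaryCurveConjugateSliceEqOfTwistedRecip` §2)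
include hψ hψ₂ ht ht₂ in
/-- **THE CONJUGATE OF `ψ` BY `σL ∈ Aut(ℂ∕τL)` EQUALS THE SECOND SLICE `ψ₂`, FROM THE FORWARD LAW** `σL|_ℚ • f[x₀, a] = f₂[x₀, d·a]` (all `a`; `s ↔ σL` an Artin
correspondent, `d` its twist at the special `x₀ = [τw]`): every `T′` over `(1 × Spec σL) ≫ ψ ≫ (1 × Spec σL|_ℚ⁻¹)` EQUALS `ψ₂` — ★ `conjSlice_eq_sliceTwo_of_twisted_recip` at
an Artin correspondent `s′` of `σL⁻¹` and its twist `d′` (which exist: ★ `exists_finiteIdele_isArtinCorrespondent_algEquiv`, ★ `exists_isDiagTwistGS_recipFactor'`, `w`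
anisotropic as `τw` is negative), the twisted law coming from the forward one by §1.
[cite: Milne2005ShimuraVarieties, Lemma 13.5 and Thm. 13.6 p. 118 L29–41; Def. 12.8 (61)–(62) p. 114] [cite: Shimura1998, §18.6 (pp. 124–127)] -/
theorem RecordSystemGS.conjSlice_eq_sliceTwo_of_forward_recip [IsSeparated M.hom]
    (hJ : (Jstar.map (IsCMField.complexConj L))ᵀ = Jstar) (hdet : IsUnit Jstar.det)
    (e : letI : Algebra L ℂ := τ.toAlgebra
      ComplexPoints ((Motives.baseChangeHom τ).obj (S.M.obj K)) ≃ₜ ShimuraSetGS L Jstar τ K.1.1)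
    (he : letI : Algebra L ℂ := τ.toAlgebra
      ∀ (v : Fin 2 → ℂ) (hv : v ∈ negCone (Jstar.map τ))
        (b : ↥(finAdelic (↥(maximalRealSubfield L)) L (IsCMField.complexConj L) 2 Jstar)),
        e.symm (ShimuraSetGS.mk L Jstar τ K.1.1 v hv b) =
          AlgPoints.baseChangeEquiv τ (S.M.obj K) ((S.pts K).symm (ShimuraSetGS.mk L Jstar τ K.1.1 v hv b)))
    (σL : letI : Algebra L ℂ := τ.toAlgebra; ℂ ≃ₐ[L] ℂ)
    {w : Fin 2 → L} (hw : (fun i => τ (w i)) ∈ negCone (Jstar.map τ)) {s : (FiniteAdeleRing (𝓞 L) L)ˣ}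
    (hs : letI : Algebra L ℂ := τ.toAlgebra; IsArtinCorrespondent L τ s σL.toRingEquiv)
    {d : ↥(finAdelic (↥(maximalRealSubfield L)) L (IsCMField.complexConj L) 2 Jstar)}
    (hd : IsDiagTwistGS L Jstar w (recipFactor L s) d)
    (T' : (Motives.baseChangeHom τ).obj (S.M.obj K) ⟶ (Motives.baseChange ℚ ℂ).obj M)
    (hT' : letI : Algebra L ℂ := τ.toAlgebra
      GaloisDescent.gal ℂ (S.M.obj K) σL⁻¹ ≫ t ≫ GaloisDescent.gal ℂ M (σL.restrictScalars ℚ) = T'.left)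
    (hfw : letI : Algebra L ℂ := τ.toAlgebra
      ∀ a : ↥(finAdelic (↥(maximalRealSubfield L)) L (IsCMField.complexConj L) 2 Jstar),
        (σL.restrictScalars ℚ) • f (ShimuraSetGS.mk L Jstar τ K.1.1 (fun i => τ (w i)) hw a) =
          f₂ (ShimuraSetGS.mk L Jstar τ K.1.1 (fun i => τ (w i)) hw (d * a))) :
    T' = ψ₂ := by
  letI iL : Algebra L ℂ := τ.toAlgebra
  obtain ⟨s', hs'⟩ := exists_finiteIdele_isArtinCorrespondent_algEquiv L τ σL⁻¹
  obtain ⟨d', hd'⟩ := exists_isDiagTwistGS_recipFactor' L Jstar hJ (hermForm_self_ne_zero_of_embedding_mem_negCone hw) s'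
  exact S.conjSlice_eq_sliceTwo_of_twisted_recip K M f f₂ ψ ψ₂ hψ hψ₂ t ht t₂ ht₂ hJ hdet e he σL hw hs' hd' T' hT'
    (S.twisted_recip_of_forward_recip K M f f₂ σL hw hs hs' hd hd' hfw)

set_option maxHeartbeats 800000 in -- large adelic ∕ Shimura-set terms: instance-heavy statements (as ★ `UnitaryCurveConjugateSliceEqOfTwistedRecip` §2)
include hψ hψ₂ ht ht₂ in
/-- **The same on underlying morphisms, from the forward law: `gal σL⁻¹ ≫ ψ.left ≫ gal σL|_ℚ = ψ₂.left`.**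
[cite: Milne2005ShimuraVarieties, Lemma 13.5 and Thm. 13.6 p. 118 L29–41; Def. 12.8 (61)–(62) p. 114] [cite: Shimura1998, §18.6 (pp. 124–127)] -/
theorem RecordSystemGS.gal_comp_sliceComplex_comp_gal_eq_sliceTwo_of_forward_recip [IsSeparated M.hom]
    (hJ : (Jstar.map (IsCMField.complexConj L))ᵀ = Jstar) (hdet : IsUnit Jstar.det)
    (e : letI : Algebra L ℂ := τ.toAlgebra
      ComplexPoints ((Motives.baseChangeHom τ).obj (S.M.obj K)) ≃ₜ ShimuraSetGS L Jstar τ K.1.1)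
    (he : letI : Algebra L ℂ := τ.toAlgebra
      ∀ (v : Fin 2 → ℂ) (hv : v ∈ negCone (Jstar.map τ))
        (b : ↥(finAdelic (↥(maximalRealSubfield L)) L (IsCMField.complexConj L) 2 Jstar)),
        e.symm (ShimuraSetGS.mk L Jstar τ K.1.1 v hv b) =
          AlgPoints.baseChangeEquiv τ (S.M.obj K) ((S.pts K).symm (ShimuraSetGS.mk L Jstar τ K.1.1 v hv b)))
    (σL : letI : Algebra L ℂ := τ.toAlgebra; ℂ ≃ₐ[L] ℂ)
    {w : Fin 2 → L} (hw : (fun i => τ (w i)) ∈ negCone (Jstar.map τ)) {s : (FiniteAdeleRing (𝓞 L) L)ˣ}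
    (hs : letI : Algebra L ℂ := τ.toAlgebra; IsArtinCorrespondent L τ s σL.toRingEquiv)
    {d : ↥(finAdelic (↥(maximalRealSubfield L)) L (IsCMField.complexConj L) 2 Jstar)}
    (hd : IsDiagTwistGS L Jstar w (recipFactor L s) d)
    (hfw : letI : Algebra L ℂ := τ.toAlgebra
      ∀ a : ↥(finAdelic (↥(maximalRealSubfield L)) L (IsCMField.complexConj L) 2 Jstar),
        (σL.restrictScalars ℚ) • f (ShimuraSetGS.mk L Jstar τ K.1.1 (fun i => τ (w i)) hw a) =
          f₂ (ShimuraSetGS.mk L Jstar τ K.1.1 (fun i => τ (w i)) hw (d * a))) :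
    letI : Algebra L ℂ := τ.toAlgebra
    GaloisDescent.gal ℂ (S.M.obj K) σL⁻¹ ≫ t ≫ GaloisDescent.gal ℂ M (σL.restrictScalars ℚ) = t₂ := by
  letI iL : Algebra L ℂ := τ.toAlgebra
  obtain ⟨s', hs'⟩ := exists_finiteIdele_isArtinCorrespondent_algEquiv L τ σL⁻¹
  obtain ⟨d', hd'⟩ := exists_isDiagTwistGS_recipFactor' L Jstar hJ (hermForm_self_ne_zero_of_embedding_mem_negCone hw) s'
  exact S.gal_comp_sliceComplex_comp_gal_eq_sliceTwo K M f f₂ ψ ψ₂ hψ hψ₂ t ht t₂ ht₂ hJ hdet e he σL hw hs' hd'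
    (S.twisted_recip_of_forward_recip K M f f₂ σL hw hs hs' hd hd' hfw)

end TwoSlices

end Literature.AlgebraicGeometry.ShimuraVarieties.UnitaryCanonicalModel

end
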